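import Summits.QuantumFields.BalabanUV.Beta.D1BFx.GluonKernel
import Summits.QuantumFields.BalabanUV.Beta.D1BFx.DressedBubbleBridge

/-!
# `BalabanUV.Beta.D1BFx.GluonKernelSectors` — road «BF-x» for binder row D1, sub-leaf A0-sec: THE SECTOR EXPANSION OF THE GLUON FINE
# KERNEL — `Pgl = ½·tadpole(W) − ½·Σ_{i,j} c_i c_j · bubble(V_i, V_j)` over the three reduced first-order sectors E (Wilson), Λ (Lagrange),
# R (gauge term) of T4-inst's stencil, under the one honest binder on the gluon leg

HONEST DEPENDENCY (page 1, mandatory): continuum YM on T⁴ ⇐ BetaPertH ∧ nine spine estimates (0/9 proved); BetaPertH ⇐ (D1) ∧ (D4) ∧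
CAP+tail; G-an2-4 gates asym, D1 and NE2/3/4.  HONEST FRAMING (cell contract, verbatim): «discharging `BetaPertH` makes Bałaban's UV
stability UNCONDITIONAL — a real constructive-QFT result; it is NOT the continuum limit and NOT the Clay problem.»  THIS MODULE
DISCHARGES NOTHING of the wall: [our objects] three reduced sector stencil families + their packing, and [folklore] LINEAR ALGEBRA OF
ABSOLUTELY CONVERGENT LATTICE SUMS — additivity of the `ℋ`-weighted superposition (`ChartConjugationReflection.wsum_add` with the summable
weights of `KernelSpecInstance.decay_wH`) and bilinearity of the bubble (`TameKernelCalculus.bubble_add_*`, an1's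
`KernelWardRelative.bubble_finset_sum_left`, leaf-01's `DressedBubbleBridge.bubble_finset_sum_right`, `KernelReflection.bubble_smul_*`) — over
this seat's T7-gl `GluonKernel.Pgl` (p213344) and T4-inst `FineStencilBFBalaban.SbfBal` (p213087), the typer's T4 `FineStencilBF.Sbf_eq_sectors`
(p212927), an2's `BalabanStepJets.locStencil_S0` and `StepJetData.locStencil_wilsonA`.  No `Prop` is minted; nothing printed is asserted;
0 binders of row D1 touched.  Road scaffolding for ONE road to ONE conjunct (D1).  NOT D1, NOT `BetaPertH`, NOT continuum, NOT Clay.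
ABSOLUTE RULE (cell charter, verbatim): «No internally-minted statement may enter as a cited fact. Every hypothesis is either
kernel-proved in this package or a verbatim quotation of a PUBLISHED theorem with page reference. The manuscript(s) under audit are NOT
citable for their own disputed steps — they are the thing under adjudication; programme-internal (2001/route/tribunal) claims are never
citable.»  Accordingly there is NO `def … : Prop` below, nothing is cited, and no hypothesis of any theorem is a printed statement.

WHY (skeleton `HOME/beta/skeletons/D1-b2b-balaban-beta-d1-p2.md` v1.4 node A; `TYPER-SPEC-D1BFx.md` §4 A0 «`Pgl + Pgh = MAIN + Σ_{τ∈REST} Pτ` … by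
expanding T4–T7 (finite sum)»; the owner's heuristic `A0-TERM-CENSUS.md`; typer LEAVES v7 «OPEN after T7: A0 → A1.ii → A3»).  The gluon one-shot
kernel `Pgl n a cE cVH cΛ cR cK cQ W = hessKer (Ga n a) (vertexRed n (SbfBal …)) W = ½·tadpole − ½·bubble` carries the first-order stencil
`SbfBal = cE • (E-sector) + cΛ • (Λ-sector) + cR • (R-sector)` (`FineStencilBF.Sbf_eq_sectors`; the vh sector has NO field–field block).  THIS
FILE is the FIRST LAYER of node A0's term list, AT KERNEL LEVEL: the dressed vertex is linear in the stencil (§2) and the bubble is bilinear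
on localised vertices over a spread leg (§3), so `Pgl` is the tadpole plus NINE sector bubbles with the weights `c_i c_j` — the parents of the
census's MAIN-gl (EE), τ4/τ5-type (EΛ/ER) and τ6-type (ΛΛ/ΛR/RR) rows (orientation only; no power count is asserted here).  The finer leg
split `Ga = diag gFree + E_n` (leaf-08's grades), the MAIN/REST census and every estimate are the A-leaves' and compose ON TOP of this identity.

CONTENT (`d = 4`; `n` block side, `[NeZero n]`; `0 < a`).
* §1 [our objects] `SbE`, `SbL n`, `SbR n a cK cQ` (the three REDUCED sector stencils), `secSt n a cK cQ : Fin 3 → StencilR`, `secWt cE cΛ cR : Fin 3 → ℝ`;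
  `SbfBal_eq_secSum` (`SbfBal … κ u = Σ i, secWt i • secSt i κ u`); BINDER-FREE per-sector localisation `exists_biLoc_SbE/SbL/SbR`, `exists_biLoc_secSt`.
* §2 LINEARITY OF THE REDUCED VERTEX: `vertexRed_smul`, `vertexRed_add` (bounded, bi-localised stencil families), `vertexRed_secSum`,
  **`vertexRed_SbfBal_eq_secSum`**; `exists_vertexFamily_secSt` (each dressed sector vertex is a `VertexFamily`), `loc_vertexRed_secSt`.
* §3 THE EXPANSION under the ONE honest binder `hGa : Decays (Ga n a) C δ` (B5 Prop. 1.2 content, NOT in the tree — T1/T8's discipline; it is what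
  makes the bubble absolutely convergent, hence bilinear): **`Pgl_eq_sectors`**:
  `Pgl n a cE cVH cΛ cR cK cQ W μ ν z = ½·tadpole (Ga n a) (W μ 0 ν z) − ½·Σ_{i : Fin 3} Σ_{j : Fin 3} secWt i · secWt j · bubble (Ga n a) (vertexRed n (secSt i) μ 0) (vertexRed n (secSt j) ν z)`,
  and `Pgl_indep_cVH` (the gluon kernel does not see `cVH`).
NOT HERE: the leg split, the census exponents, the tadpole's table `W` (T5), colour/loop weights, any estimate.  Unit `b2b-balaban-beta-d1-formalise-leaf-05`
(gen 3), D1 formalisation swarm; `LEAVES-BFx.md` sub-row A0-sec.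
-/

noncomputable section

namespace Summit.QuantumFields.BalabanUV.Beta.D1BFx.GluonKernelSectors

open Finset
open Literature.MathematicalPhysics.QuantumFieldTheory.Balaban1983to89
open Literature.MathematicalPhysics.QuantumFieldTheory.Balaban1983to89.Beta
open B12Sec2to5 (l1 l1_nonneg Decay510)
open ExpKernelCalculus (Site MKer Decays BiLoc VertexFamily VertexFamily₂ hessKer bubble tadpole summable_exp_shift')
open OneStepResolventKernel (Fib LocStencil KInv wsum biLoc_mono)
open StepJetData (wilsonA locStencil_wilsonA)
open AveragingHessianKernels (vhS hessFF)
open InterLevelTransport (SLam)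
open BalabanStepJets (S0 lamCoeffOf locStencil_S0)
open KernelSpecInstance (wH decay_wH)
open KernelReflection (bubble_smul_left bubble_smul_right)
open Summit.QuantumFields.BalabanUV.Beta.TameKernelCalculus (Spr Loc Loc.smul)
open Summit.QuantumFields.BalabanUV.Beta.ChartConjugationReflection (wsum_add)
open Summit.QuantumFields.BalabanUV.Beta.KernelWardRelative (bubble_finset_sum_left loc_finset_sum)
open Summit.QuantumFields.BalabanUV.Beta.D1BFx.DressedBubbleBridge (bubble_finset_sum_right)
open Summit.QuantumFields.BalabanUV.Beta.D1BFx.GluonLeg (Ga)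
open Summit.QuantumFields.BalabanUV.Beta.D1BFx.ReducedKernel (StencilR TableR vertexRed vertexRed_apply vertexFamily_vertexRed')
open Summit.QuantumFields.BalabanUV.Beta.D1BFx.FineStencilBF (ffOf biLoc_ffOf_of_locStencil Sbf_eq_sectors)
open Summit.QuantumFields.BalabanUV.Beta.D1BFx.RProjectorJet (Rdot)
open Summit.QuantumFields.BalabanUV.Beta.D1BFx.RJetProjector (Rjet biLoc_Rjet)
open Summit.QuantumFields.BalabanUV.Beta.D1BFx.FineStencilBFBalaban (SbfBal SbfBal_def rate0 rate0_pos cRdotBal biLoc_Rdot_bal)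
open Summit.QuantumFields.BalabanUV.Beta.D1BFx.GluonKernel (Pgl Pgl_eq)

variable (n : ℕ) [NeZero n] (a : ℝ)

/-! ## §1 The three reduced sector stencils and their localisation -/

/-- [our object] THE WILSON (E) SECTOR of the reduced BF stencil: the field–field block of an2's colourless Wilson cubic `wilsonA 3 κ u`. -/
def SbE : StencilR := fun κ u => ffOf (wilsonA 3 κ u)

/-- [our object] THE LAGRANGE (Λ) SECTOR: the field–field block of the Lagrange stencil `SLam n (lamCoeffOf (KInv n) n) (hessFF n)`. -/
def SbL (n : ℕ) [NeZero n] : StencilR := fun κ u =>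
  ffOf (SLam n (lamCoeffOf (KInv (N := n) (d := 3)) n) (fun μ y => hessFF n μ y) κ u)

/-- [our object] THE GAUGE-TERM (R) SECTOR: the bond-level R-jet at Bałaban's `U = 1` gauge term, `Rjet n a (Rdot n a cK cQ)` (J5-asm/J5-kernel). -/
def SbR (n : ℕ) [NeZero n] (a cK cQ : ℝ) : StencilR := Rjet n a (Rdot n a cK cQ)

/-- [our object] The three sectors packed as a `Fin 3`-family: `0 ↦ E`, `1 ↦ Λ`, `2 ↦ R`. -/
def secSt (n : ℕ) [NeZero n] (a cK cQ : ℝ) : Fin 3 → StencilR := ![SbE, SbL n, SbR n a cK cQ]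

/-- [our object] The three sector weights: `0 ↦ cE`, `1 ↦ cΛ`, `2 ↦ cR`. -/
def secWt (cE cΛ cR : ℝ) : Fin 3 → ℝ := ![cE, cΛ, cR]

variable (cE cVH cΛ cR cK cQ : ℝ)

/-- [our object] Unfoldings of the packing. -/
theorem secSt_zero : secSt n a cK cQ 0 = SbE := rfl
/-- [our object] Unfolding. -/
theorem secSt_one : secSt n a cK cQ 1 = SbL n := rfl
/-- [our object] Unfolding. -/
theorem secSt_two : secSt n a cK cQ 2 = SbR n a cK cQ := rfl
/-- [our object] Unfolding. -/
theorem secWt_zero : secWt cE cΛ cR 0 = cE := rfl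
/-- [our object] Unfolding. -/
theorem secWt_one : secWt cE cΛ cR 1 = cΛ := rfl
/-- [our object] Unfolding. -/
theorem secWt_two : secWt cE cΛ cR 2 = cR := rfl

/-- [folklore] **T4-inst's STENCIL IS THE WEIGHTED SUM OF ITS THREE SECTORS** (`FineStencilBF.Sbf_eq_sectors`; `cVH` does not occur). -/
theorem SbfBal_eq_secSum (κ : Fin 4) (u : Site 4) :
    SbfBal n a cE cVH cΛ cR cK cQ κ u = ∑ i : Fin 3, secWt cE cΛ cR i • secSt n a cK cQ i κ u := by
  rw [Fin.sum_univ_three, secWt_zero, secWt_one, secWt_two, secSt_zero, secSt_one, secSt_two, SbfBal_def, Sbf_eq_sectors]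
  rfl

/-- [folklore] The E sector is bi-localised at its bond, binder-free (`locStencil_wilsonA` at rate `1`). -/
theorem exists_biLoc_SbE : ∃ Cs δ : ℝ, 0 < δ ∧ ∀ (κ : Fin 4) (u : Site 4), BiLoc (SbE κ u) u u Cs δ :=
  ⟨_, 1, one_pos, fun κ u => biLoc_ffOf_of_locStencil (locStencil_wilsonA (d := 3) zero_le_one) κ u⟩

/-- [folklore] The Λ sector is bi-localised at its bond, binder-free (an2's `locStencil_S0` at the weights `(0, 0, 1)`). -/
theorem exists_biLoc_SbL : ∃ Cs δ : ℝ, 0 < δ ∧ ∀ (κ : Fin 4) (u : Site 4), BiLoc (SbL n κ u) u u Cs δ := by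
  obtain ⟨Cs, δ, hδ, hS⟩ := locStencil_S0 (d := 3) (Lc := n) NeZero.one_le 0 0 1
  refine ⟨Cs, δ, hδ, fun κ u => ?_⟩
  have e : SbL n κ u = ffOf (S0 3 n 0 0 1 κ u) := by
    funext x z α β
    simp only [SbL, S0, FineStencilBF.ffOf_apply, Pi.add_apply, Pi.smul_apply, smul_eq_mul, zero_mul, zero_add, one_mul]
  rw [e]
  exact biLoc_ffOf_of_locStencil hS κ u

/-- [folklore] The R sector is bi-localised at its bond, binder-free (`biLoc_Rjet` fed with T4-inst's `biLoc_Rdot_bal`; rate `rate0 n a / 8`). -/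
theorem exists_biLoc_SbR (ha : 0 < a) : ∃ Cs δ : ℝ, 0 < δ ∧ ∀ (κ : Fin 4) (u : Site 4), BiLoc (SbR n a cK cQ κ u) u u Cs δ := by
  have h0 := rate0_pos n a ha
  have hle : rate0 n a / 8 ≤ RProjector.deltaPP 4 a / (4 * (n : ℝ)) := by unfold rate0 at h0 ⊢; linarith
  exact ⟨4 * ((1 + RProjector.cPP 4 (n - 1) a * Real.exp (RProjector.deltaPP 4 a)) + cRdotBal n a cK cQ) * Real.exp (2 * (rate0 n a / 8)),
    rate0 n a / 8, by positivity, fun κ u => biLoc_Rjet n a ha κ u (by positivity) hle (biLoc_Rdot_bal n a ha cK cQ κ u)⟩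

/-- [folklore] **EVERY SECTOR IS A BI-LOCALISED STENCIL FAMILY**, binder-free but `0 < a`. -/
theorem exists_biLoc_secSt (ha : 0 < a) (i : Fin 3) :
    ∃ Cs δ : ℝ, 0 < δ ∧ ∀ (κ : Fin 4) (u : Site 4), BiLoc (secSt n a cK cQ i κ u) u u Cs δ := by
  fin_cases i
  · exact exists_biLoc_SbE
  · exact exists_biLoc_SbL n
  · exact exists_biLoc_SbR n a cK cQ ha

/-! ## §2 Linearity of the reduced vertex -/

/-- [folklore] The reduced vertex is homogeneous in the stencil family (no hypothesis: `tsum_mul_left`). -/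
theorem vertexRed_smul (c : ℝ) (S : StencilR) (μ : Fin 4) (y : Site 4) :
    vertexRed n (fun κ u => c • S κ u) μ y = c • vertexRed n S μ y := by
  funext x z α β
  simp only [vertexRed_apply, Pi.smul_apply, smul_eq_mul, wsum, Finset.mul_sum]
  refine Finset.sum_congr rfl fun κ _ => ?_
  rw [← tsum_mul_left]
  exact tsum_congr fun u => by ring

/-- [folklore] A bi-localised family with nonnegative rate is uniformly bounded by its constant. -/
theorem abs_le_of_biLoc {S : StencilR} {Cs δ : ℝ} (hS : ∀ κ u, BiLoc (S κ u) u u Cs δ) (hδ : 0 ≤ δ)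
    (κ : Fin 4) (u x z : Site 4) (α β : Fin 4) : |S κ u x z α β| ≤ Cs := by
  have hC : 0 ≤ Cs := (hS κ u).nonneg α
  refine (hS κ u x z α β).trans (mul_le_of_le_one_right hC ?_)
  rw [Real.exp_le_one_iff]
  have := l1_nonneg (x - u); have := l1_nonneg (z - u)
  nlinarith

/-- [folklore] The `ℋ`-weights of the reduced vertex are absolutely summable (`KernelSpecInstance.decay_wH`). -/
theorem summable_abs_wH (κ μ : Fin 4) (y : Site 4) : Summable fun u : Site 4 => |wH (N := n) (d := 3) κ μ (u - (n : ℤ) • y)| := by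
  obtain ⟨δw, Cw, hδw, hwH⟩ := decay_wH (N := n) (d := 3)
  refine Summable.of_nonneg_of_le (fun u => abs_nonneg _) (fun u => hwH κ μ (u - (n : ℤ) • y)) ?_
  exact (summable_exp_shift' hδw ((n : ℤ) • y)).mul_left Cw

/-- [folklore] **THE REDUCED VERTEX IS ADDITIVE** on bi-localised stencil families (`wsum_add` termwise). -/
theorem vertexRed_add {S T : StencilR} {Cs δs Ct δt : ℝ} (hS : ∀ κ u, BiLoc (S κ u) u u Cs δs) (hδs : 0 ≤ δs)
    (hT : ∀ κ u, BiLoc (T κ u) u u Ct δt) (hδt : 0 ≤ δt) (μ : Fin 4) (y : Site 4) :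
    vertexRed n (fun κ u => S κ u + T κ u) μ y = vertexRed n S μ y + vertexRed n T μ y := by
  funext x z α β
  simp only [vertexRed_apply, Pi.add_apply, ← Finset.sum_add_distrib]
  refine Finset.sum_congr rfl fun κ _ => ?_
  have hB : ∀ u x z α β, |S κ u x z α β| ≤ max Cs Ct := fun u x z α β =>
    (abs_le_of_biLoc hS hδs κ u x z α β).trans (le_max_left _ _)
  have hB' : ∀ u x z α β, |T κ u x z α β| ≤ max Cs Ct := fun u x z α β =>
    (abs_le_of_biLoc hT hδt κ u x z α β).trans (le_max_right _ _)
  have h := wsum_add (w := fun u => wH (N := n) (d := 3) κ μ (u - (n : ℤ) • y)) (S := S κ) (T := T κ) (summable_abs_wH n κ μ y) hB hB'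
  exact congrFun (congrFun (congrFun (congrFun h x) z) α) β

/-- [folklore] The reduced vertex of a weighted sum of THREE bi-localised sector families is the weighted sum of their reduced vertices. -/
theorem vertexRed_secSum (ha : 0 < a) (μ : Fin 4) (y : Site 4) :
    vertexRed n (fun κ u => ∑ i : Fin 3, secWt cE cΛ cR i • secSt n a cK cQ i κ u) μ y =
      ∑ i : Fin 3, secWt cE cΛ cR i • vertexRed n (secSt n a cK cQ i) μ y := by
  obtain ⟨C0, δ0, hδ0, h0⟩ := exists_biLoc_secSt n a cK cQ ha 0
  obtain ⟨C1, δ1, hδ1, h1⟩ := exists_biLoc_secSt n a cK cQ ha 1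
  obtain ⟨C2, δ2, hδ2, h2⟩ := exists_biLoc_secSt n a cK cQ ha 2
  -- scaled families stay bi-localised
  have s0 : ∀ κ u, BiLoc (secWt cE cΛ cR 0 • secSt n a cK cQ 0 κ u) u u (|secWt cE cΛ cR 0| * C0) δ0 :=
    fun κ u => GhostKernel.biLoc_smul' _ (h0 κ u)
  have s1 : ∀ κ u, BiLoc (secWt cE cΛ cR 1 • secSt n a cK cQ 1 κ u) u u (|secWt cE cΛ cR 1| * C1) δ1 :=
    fun κ u => GhostKernel.biLoc_smul' _ (h1 κ u)
  have s2 : ∀ κ u, BiLoc (secWt cE cΛ cR 2 • secSt n a cK cQ 2 κ u) u u (|secWt cE cΛ cR 2| * C2) δ2 :=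
    fun κ u => GhostKernel.biLoc_smul' _ (h2 κ u)
  -- the sum of the first two is bi-localised at the smaller rate
  have s01 : ∀ κ u, BiLoc (secWt cE cΛ cR 0 • secSt n a cK cQ 0 κ u + secWt cE cΛ cR 1 • secSt n a cK cQ 1 κ u) u u
      (|secWt cE cΛ cR 0| * C0 + |secWt cE cΛ cR 1| * C1) (min δ0 δ1) := fun κ u =>
    KernelWard.biLoc_add (biLoc_mono (s0 κ u) ((s0 κ u).nonneg 0) (min_le_left _ _))
      (biLoc_mono (s1 κ u) ((s1 κ u).nonneg 0) (min_le_right _ _))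
  simp only [Fin.sum_univ_three]
  rw [vertexRed_add n s01 (le_min hδ0.le hδ1.le) s2 hδ2.le, vertexRed_add n s0 hδ0.le s1 hδ1.le, vertexRed_smul, vertexRed_smul,
    vertexRed_smul]

/-- [folklore] **THE DRESSED GLUON VERTEX IS THE WEIGHTED SUM OF THE THREE DRESSED SECTOR VERTICES.** -/
theorem vertexRed_SbfBal_eq_secSum (ha : 0 < a) (μ : Fin 4) (y : Site 4) :
    vertexRed n (SbfBal n a cE cVH cΛ cR cK cQ) μ y = ∑ i : Fin 3, secWt cE cΛ cR i • vertexRed n (secSt n a cK cQ i) μ y := by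
  have e : SbfBal n a cE cVH cΛ cR cK cQ = fun κ u => ∑ i : Fin 3, secWt cE cΛ cR i • secSt n a cK cQ i κ u := by
    funext κ u; exact SbfBal_eq_secSum n a cE cVH cΛ cR cK cQ κ u
  rw [e, vertexRed_secSum n a cE cΛ cR cK cQ ha]

/-- [folklore] Every dressed sector vertex is a `VertexFamily` at the coarse bonds (some constant, positive rate; binder-free but `0 < a`). -/
theorem exists_vertexFamily_secSt (ha : 0 < a) (i : Fin 3) :
    ∃ Cv δv : ℝ, 0 < δv ∧ VertexFamily (vertexRed n (secSt n a cK cQ i)) n Cv δv := by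
  obtain ⟨Cs, δ, hδ, hS⟩ := exists_biLoc_secSt n a cK cQ ha i
  obtain ⟨Cv, δv, hδv, -, hV⟩ := vertexFamily_vertexRed' n hS hδ
  exact ⟨Cv, δv, hδv, hV⟩

/-- [folklore] … hence localised in the `TameKernelCalculus` sense. -/
theorem loc_vertexRed_secSt (ha : 0 < a) (i : Fin 3) (μ : Fin 4) (y : Site 4) : Loc (vertexRed n (secSt n a cK cQ i) μ y) := by
  obtain ⟨Cv, δv, hδv, hV⟩ := exists_vertexFamily_secSt n a cK cQ ha i
  exact ⟨_, _, Cv, δv, hδv, hV μ y⟩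

/-! ## §3 The sector expansion of the gluon fine kernel -/

/-- [folklore] **A0, FIRST LAYER — THE SECTOR EXPANSION OF THE GLUON FINE KERNEL.**  Under the ONE honest binder `Decays (Ga n a) C δ` (the
leg is spread, so the bubble converges absolutely and is bilinear on localised vertices):
`Pgl … W μ ν z = ½·tadpole (Ga n a) (W μ 0 ν z) − ½·Σ_i Σ_j secWt i · secWt j · bubble (Ga n a) (vertexRed n (secSt i) μ 0) (vertexRed n (secSt j) ν z)`
— the tadpole plus NINE sector bubbles (EE, EΛ, ER, ΛE, ΛΛ, ΛR, RE, RΛ, RR). -/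
theorem Pgl_eq_sectors (ha : 0 < a) {C δ : ℝ} (hGa : Decays (Ga n a) C δ) (hδ : 0 < δ) (W : TableR) (μ ν : Fin 4) (z : Site 4) :
    Pgl n a cE cVH cΛ cR cK cQ W μ ν z =
      (1 / 2) * tadpole (Ga n a) (W μ 0 ν z) -
        (1 / 2) * ∑ i : Fin 3, ∑ j : Fin 3, secWt cE cΛ cR i * secWt cE cΛ cR j *
          bubble (Ga n a) (vertexRed n (secSt n a cK cQ i) μ 0) (vertexRed n (secSt n a cK cQ j) ν z) := by
  have hA : Spr (Ga n a) := ⟨C, δ, hδ, hGa⟩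
  have hL : ∀ (i : Fin 3) (μ' : Fin 4) (y : Site 4), Loc (secWt cE cΛ cR i • vertexRed n (secSt n a cK cQ i) μ' y) :=
    fun i μ' y => Loc.smul _ (loc_vertexRed_secSt n a cK cQ ha i μ' y)
  rw [Pgl_eq, hessKer, vertexRed_SbfBal_eq_secSum n a cE cVH cΛ cR cK cQ ha, vertexRed_SbfBal_eq_secSum n a cE cVH cΛ cR cK cQ ha,
    bubble_finset_sum_left _ hA (fun i => hL i μ 0) (loc_finset_sum _ fun j => hL j ν z)]
  congr 1
  congr 1
  refine Finset.sum_congr rfl fun i _ => ?_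
  rw [bubble_finset_sum_right _ hA (hL i μ 0) (fun j => hL j ν z)]
  refine Finset.sum_congr rfl fun j _ => ?_
  rw [bubble_smul_left, bubble_smul_right]
  ring

/-- [folklore] The gluon fine kernel does not see the vh weight `cVH` (the vh sector has no field–field block). -/
theorem Pgl_indep_cVH (cVH' : ℝ) (W : TableR) : Pgl n a cE cVH cΛ cR cK cQ W = Pgl n a cE cVH' cΛ cR cK cQ W := by
  have e : SbfBal n a cE cVH cΛ cR cK cQ = SbfBal n a cE cVH' cΛ cR cK cQ := by
    funext κ u; rw [SbfBal_eq_secSum, SbfBal_eq_secSum]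
  rw [Pgl_eq, Pgl_eq, e]

end Summit.QuantumFields.BalabanUV.Beta.D1BFx.GluonKernelSectors

end
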